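import Mathlib
import Literature.Computability.Complexity.RossmanMonotoneCliqueGraphs
import Summits.PneNP.PneNP.Theorems.ConvexRankGatesLinAlgGateBlindDefs
import Summits.PneNP.PneNP.Theorems.ConvexRankGatesLinAlgGateBlindDenseRegimeAux

/-!
# Stub `stub_denseRegime` of line `dnf-invariant-wide-gates-see-small-cliques` for crux `LinAlgGateBlind`
(stmt-PneNP-10681, route ConvexRankGates)

The dense regime of the Alon–Boppana parameter calculus at `δ = 1/8`: with `k = kOf m = ⌈m^{1/8}⌉₊`,
`l = lOf m = ⌊√(k/(4 log₂ m + 1))⌋₊`, `r = rOf c m = (l + c + 2)(⌊log₂ m⌋ + 1) + 2`, `q = qOf m = 1 - 4 ln m/k`,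
`ε = epsOf c m = m^{-(c+1)}/4` (definitions: `ConvexRankGatesLinAlgGateBlindDefs`), for every `c` all ten
conjuncts of the registered statement `stub_denseRegime` hold eventually in `m`:
`l ≥ 2`, `r ≥ 2`, `k ≤ m`, `0 ≤ q ≤ 1`, the plucking budget `|𝒱(l)| (1 - q^{C(l,2)})^r ≤ ε`
(`Razborov.card_smallSets_le`, `m + 1 ≤ 2^{⌊log₂ m⌋+1}`), the trimming budget
`((r-1)^l)² C(m-l-1, k-l-1) ≤ ε C(m,k)` (`choose_sub_mul_pow_le_pow_mul_choose` and the scale `x = m^{1/16}`: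
`2^{l+3} x^{6l+16c+18} ≤ x^{16(l+1)}`), `m^c ε ≤ 1/16`, the first moment
`Pr_{G(m,q)}[ω ≥ k] ≤ C(m,k) q^{C(k,2)} ≤ m^k m^{-2(k-1)} ≤ 1/4` (`gnpProb_clique_le`, `1 - t ≤ e^{-t}`), and
`q^{C(l,2)} ≥ 1/2` (Bernoulli). The parameter asymptotics (`denseRegime_params` and the pointwise bounds in
namespace `….DenseRegime`) are in `ConvexRankGatesLinAlgGateBlindDenseRegimeAux`. Sources: Alon–Boppana 1987 §3,
Razborov 1985 (parameter choice); Rossman 2008 Lemma 2.1 (first moment). [folklore]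
-/

-- `Summit.PneNP.PneNP.…` duplicates `PneNP` BY DESIGN (single-problem summit).
set_option linter.dupNamespace false

noncomputable section

namespace Summit.PneNP.PneNP.Cruxes.LinAlgGateBlind.DnfInvariantWideGatesSeeSmallCliques

open scoped BigOperators
open Finset Filter Literature.Computability.Complexity Razborov

namespace DenseRegime

/-- **Plucking budget, conjunct (6).** `|𝒱(l)|·(1 - q^{C(l,2)})^r ≤ (m+1)^l 2^{-r} ≤ ε`, from
`q^{C(l,2)} ≥ 1/2`, `card_smallSets_le` and `4 (m+1)^l m^{c+1} ≤ 2^r`. [folklore] -/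
theorem plucking_le {c m : ℕ} (hm : 1 ≤ m) (hLk : 4 * Real.log m ≤ (kOf m : ℝ)) :
    (#(smallSets (Fin m) (lOf m)) : ℝ) * (1 - qOf m ^ ((lOf m).choose 2)) ^ rOf c m ≤ epsOf c m := by
  have hhalf := half_le_qOf_pow hm hLk
  have hq0 := qOf_nonneg hm hLk
  have hq1 := qOf_le_one m
  have hqN1 : qOf m ^ ((lOf m).choose 2) ≤ 1 := pow_le_one₀ hq0 hq1
  have hb0 : 0 ≤ 1 - qOf m ^ ((lOf m).choose 2) := by linarith
  have hb1 : 1 - qOf m ^ ((lOf m).choose 2) ≤ 1 / 2 := by linarith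
  have hcard : (#(smallSets (Fin m) (lOf m)) : ℝ) ≤ ((m + 1 : ℕ) : ℝ) ^ lOf m := by
    have := card_smallSets_le (α := Fin m) (lOf m)
    rw [Fintype.card_fin] at this
    exact_mod_cast this
  have hnat := four_mul_pow_le_two_pow_rOf c m
  have hnat' : (4 : ℝ) * ((m + 1 : ℕ) : ℝ) ^ lOf m * (m : ℝ) ^ (c + 1) ≤ (2 : ℝ) ^ rOf c m := by
    exact_mod_cast hnat
  have hmpos : (0 : ℝ) < m := by exact_mod_cast hm
  calc (#(smallSets (Fin m) (lOf m)) : ℝ) * (1 - qOf m ^ ((lOf m).choose 2)) ^ rOf c m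
      ≤ ((m + 1 : ℕ) : ℝ) ^ lOf m * (1 / 2) ^ rOf c m :=
        mul_le_mul hcard (pow_le_pow_left₀ hb0 hb1 _) (pow_nonneg hb0 _) (by positivity)
    _ = ((m + 1 : ℕ) : ℝ) ^ lOf m / 2 ^ rOf c m := by rw [one_div, inv_pow, div_eq_mul_inv]
    _ ≤ epsOf c m := by
        rw [epsOf_eq, div_le_div_iff₀ (by positivity) (by positivity), one_mul]
        linarith

/-- **Trimming budget, conjunct (7).** `((r-1)^l)² C(m-l-1, k-l-1) ≤ ε C(m,k)`: by
`choose_sub_mul_pow_le_pow_mul_choose`, `C(m-l-1,k-l-1) m^{l+1} ≤ k^{l+1} C(m,k)`, and with `x = m^{1/16}`,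
`r ≤ x²`, `k ≤ 2x²`: `4 (x²)^{2l} (2x²)^{l+1} x^{16(c+1)} = 2^{l+3} x^{6l+16c+18} ≤ x^{16(l+1)}` once `x ≥ 2`
and `9l ≥ 16c + 5`. [folklore] -/
theorem trimming_le {c m : ℕ} (hm : 1 ≤ m) (hx2 : (2 : ℝ) ≤ (m : ℝ) ^ (1 / 16 : ℝ))
    (hr : (rOf c m : ℝ) ≤ ((m : ℝ) ^ (1 / 16 : ℝ)) ^ 2) (hl : 2 * c + 1 ≤ lOf m)
    (hlk : lOf m + 1 ≤ kOf m) :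
    ((((rOf c m - 1) ^ lOf m) ^ 2 * (m - (lOf m + 1)).choose (kOf m - (lOf m + 1)) : ℕ) : ℝ)
      ≤ epsOf c m * (m.choose (kOf m) : ℝ) := by
  set x := (m : ℝ) ^ (1 / 16 : ℝ) with hxdef
  set l := lOf m
  set k := kOf m
  set r := rOf c m
  have hkm : k ≤ m := kOf_le_self m
  have hnat := choose_sub_mul_pow_le_pow_mul_choose (l + 1) m k hlk hkm
  have hmx : (m : ℝ) = x ^ 16 := (rpow_sixteenth_pow m).symm
  have hmpos : (0 : ℝ) < m := by exact_mod_cast hm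
  have hx0 : (0 : ℝ) ≤ x := Real.rpow_nonneg (Nat.cast_nonneg m) _
  have hx1 : (1 : ℝ) ≤ x := by linarith
  have hk2 : (k : ℝ) ≤ 2 * x ^ 2 := kOf_le_two_mul_sq hm
  have hr1 : ((r - 1 : ℕ) : ℝ) ≤ x ^ 2 := le_trans (by exact_mod_cast Nat.sub_le r 1) hr
  have hreal : (((m - (l + 1)).choose (k - (l + 1)) : ℕ) : ℝ) * (m : ℝ) ^ (l + 1) ≤
      (k : ℝ) ^ (l + 1) * (m.choose k : ℝ) := by
    exact_mod_cast hnat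
  have hC : (0 : ℝ) ≤ (m.choose k : ℝ) := Nat.cast_nonneg _
  have key : 2 ^ (l + 1) * x ^ (6 * l + 2) * (4 * (x ^ 16) ^ (c + 1)) ≤ (x ^ 16) ^ (l + 1) := by
    have h2x : (2 : ℝ) ^ (l + 3) ≤ x ^ (l + 3) := pow_le_pow_left₀ (by norm_num) hx2 _
    calc 2 ^ (l + 1) * x ^ (6 * l + 2) * (4 * (x ^ 16) ^ (c + 1))
        = 2 ^ (l + 3) * x ^ (6 * l + 16 * c + 18) := by ring
      _ ≤ x ^ (l + 3) * x ^ (6 * l + 16 * c + 18) := mul_le_mul_of_nonneg_right h2x (by positivity)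
      _ = x ^ (7 * l + 16 * c + 21) := by rw [← pow_add]; ring_nf
      _ ≤ x ^ (16 * (l + 1)) := pow_le_pow_right₀ hx1 (by omega)
      _ = (x ^ 16) ^ (l + 1) := pow_mul x 16 (l + 1)
  rw [← mul_le_mul_iff_left₀ (pow_pos hmpos (l + 1))]
  calc ((((r - 1) ^ l) ^ 2 * (m - (l + 1)).choose (k - (l + 1)) : ℕ) : ℝ) * (m : ℝ) ^ (l + 1)
      = (((r - 1 : ℕ) : ℝ) ^ l) ^ 2 *
          ((((m - (l + 1)).choose (k - (l + 1)) : ℕ) : ℝ) * (m : ℝ) ^ (l + 1)) := by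
        simp only [Nat.cast_mul, Nat.cast_pow]; ring
    _ ≤ (((r - 1 : ℕ) : ℝ) ^ l) ^ 2 * ((k : ℝ) ^ (l + 1) * (m.choose k : ℝ)) :=
        mul_le_mul_of_nonneg_left hreal (by positivity)
    _ ≤ ((x ^ 2) ^ l) ^ 2 * ((2 * x ^ 2) ^ (l + 1) * (m.choose k : ℝ)) := by gcongr
    _ = (2 ^ (l + 1) * x ^ (6 * l + 2)) * (m.choose k : ℝ) := by ring
    _ ≤ epsOf c m * (m.choose k : ℝ) * (m : ℝ) ^ (l + 1) := by
        rw [epsOf_eq, hmx]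
        rw [show 1 / (4 * (x ^ 16) ^ (c + 1)) * (m.choose k : ℝ) * (x ^ 16) ^ (l + 1) =
            (m.choose k : ℝ) * (x ^ 16) ^ (l + 1) / (4 * (x ^ 16) ^ (c + 1)) by ring]
        rw [le_div_iff₀ (by positivity)]
        calc 2 ^ (l + 1) * x ^ (6 * l + 2) * (m.choose k : ℝ) * (4 * (x ^ 16) ^ (c + 1))
            = (2 ^ (l + 1) * x ^ (6 * l + 2) * (4 * (x ^ 16) ^ (c + 1))) * (m.choose k : ℝ) := by ring
          _ ≤ (x ^ 16) ^ (l + 1) * (m.choose k : ℝ) := mul_le_mul_of_nonneg_right key hC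
          _ = (m.choose k : ℝ) * (x ^ 16) ^ (l + 1) := mul_comm _ _

/-- First moment in the `prob` language: `Pr_{G(m,q)}[ω ≥ k] ≤ C(m,k) q^{C(k,2)}` (tree:
`gnpProb_clique_le`, `gnpProb_filter_eq_prob`). [folklore] -/
theorem prob_clique_le {m k : ℕ} {q : ℝ} (hq0 : 0 ≤ q) (hq1 : q ≤ 1) :
    prob q (fun x : KEdge m → Bool => cliqueFn m k x = true) ≤ (m.choose k : ℝ) * q ^ (k.choose 2) := by
  rw [← gnpProb_filter_eq_prob]
  exact gnpProb_clique_le hq0 hq1 k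

/-- **First moment, conjunct (9), numerically.** `C(m,k) q^{C(k,2)} ≤ m^k e^{-2(k-1) log m} = m^{2-k} ≤ 1/4`
for `k ≥ 3`, `m ≥ 4`. [folklore] -/
theorem choose_mul_qOf_pow_le {m : ℕ} (hm : 4 ≤ m) (hk : 3 ≤ kOf m) (hq0 : 0 ≤ qOf m) :
    (m.choose (kOf m) : ℝ) * qOf m ^ ((kOf m).choose 2) ≤ 1 / 4 := by
  set k := kOf m with hkdef
  have hmpos : (0 : ℝ) < m := by exact_mod_cast (show 0 < m by omega)
  have hm4 : (4 : ℝ) ≤ m := by exact_mod_cast hm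
  have hkpos : (0 : ℝ) < k := by exact_mod_cast (show 0 < k by omega)
  have hqexp : qOf m ≤ Real.exp (-(4 * Real.log m / k)) := by
    unfold qOf; exact Real.one_sub_le_exp_neg _
  have hpow : qOf m ^ (k.choose 2) ≤ Real.exp (-(4 * Real.log m / k)) ^ (k.choose 2) :=
    pow_le_pow_left₀ hq0 hqexp _
  have hNt : Real.exp (-(4 * Real.log m / k)) ^ (k.choose 2) = ((m : ℝ) ^ (2 * (k - 1)))⁻¹ := by
    rw [← Real.exp_nat_mul, Nat.cast_choose_two]
    have h1k : 1 ≤ k := by omega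
    have : (k : ℝ) * ((k : ℝ) - 1) / 2 * (-(4 * Real.log m / k)) = -(((2 * (k - 1) : ℕ) : ℝ) * Real.log m) := by
      push_cast [Nat.cast_sub h1k]
      field_simp
      ring
    rw [this, Real.exp_neg, Real.exp_nat_mul, Real.exp_log hmpos]
  have hCh : (m.choose k : ℝ) ≤ (m : ℝ) ^ k := by exact_mod_cast Nat.choose_le_pow m k
  calc (m.choose k : ℝ) * qOf m ^ (k.choose 2)
      ≤ (m : ℝ) ^ k * ((m : ℝ) ^ (2 * (k - 1)))⁻¹ := by
        rw [← hNt]; exact mul_le_mul hCh hpow (pow_nonneg hq0 _) (by positivity)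
    _ ≤ 1 / 4 := by
        rw [← div_eq_mul_inv, div_le_div_iff₀ (by positivity) (by norm_num), one_mul]
        have h2k : k + 1 ≤ 2 * (k - 1) := by omega
        calc (m : ℝ) ^ k * 4 ≤ (m : ℝ) ^ k * m := by nlinarith [pow_pos hmpos k]
          _ = (m : ℝ) ^ (k + 1) := (pow_succ _ _).symm
          _ ≤ (m : ℝ) ^ (2 * (k - 1)) := pow_le_pow_right₀ (by linarith) h2k

end DenseRegime

open DenseRegime in
/-- **Stub 4 — the dense regime at `δ = 1/8`.** All ten conjuncts hold eventually in `m`, for every `c`: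
assembled from `denseRegime_params` (Aux) and the pointwise lemmas above. [folklore] -/
theorem stub_denseRegime : ∀ c : ℕ, ∀ᶠ m : ℕ in atTop, 2 ≤ lOf m ∧ 2 ≤ rOf c m ∧ kOf m ≤ m ∧ 0 ≤ qOf m ∧ qOf m ≤ 1 ∧ (#(smallSets (Fin m) (lOf m)) : ℝ) * (1 - qOf m ^ ((lOf m).choose 2)) ^ rOf c m ≤ epsOf c m ∧ ((((rOf c m - 1) ^ lOf m) ^ 2 * (m - (lOf m + 1)).choose (kOf m - (lOf m + 1)) : ℕ) : ℝ) ≤ epsOf c m * (m.choose (kOf m) : ℝ) ∧ ((m ^ c : ℕ) : ℝ) * epsOf c m ≤ 1 / 16 ∧ prob (qOf m) (fun x : KEdge m → Bool => cliqueFn m (kOf m) x = true) ≤ 1 / 4 ∧ (1 / 2 : ℝ) ≤ qOf m ^ ((lOf m).choose 2) := by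
  intro c
  filter_upwards [denseRegime_params c] with m ⟨hm4, hL, hc, hl⟩
  have hm1 : 1 ≤ m := by omega
  have hm3 : 3 ≤ m := by omega
  have hx2 : (2 : ℝ) ≤ (m : ℝ) ^ (1 / 16 : ℝ) := by
    have : (0 : ℝ) ≤ c := Nat.cast_nonneg c
    linarith
  have hLk := four_mul_log_le_kOf hm1 hL
  have hq0 := qOf_nonneg hm1 hLk
  have hq1 := qOf_le_one m
  have hlk := lOf_add_one_le_kOf hx2
  have hr := rOf_le_sq hm3 hL hc
  have hk3 : 3 ≤ kOf m := by omega
  refine ⟨by omega, two_le_rOf c m, kOf_le_self m, hq0, hq1, plucking_le hm1 hLk,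
    trimming_le hm1 hx2 hr (by omega) hlk, pow_mul_epsOf_le hm4, ?_, half_le_qOf_pow hm1 hLk⟩
  exact (prob_clique_le hq0 hq1).trans (choose_mul_qOf_pow_le hm4 hk3 hq0)

end Summit.PneNP.PneNP.Cruxes.LinAlgGateBlind.DnfInvariantWideGatesSeeSmallCliques

end
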